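import Mathlib
import HarnessLib
import Literature.MathematicalPhysics.QuantumLattice.GrassmannEffectiveActionBound

/-!
# Route `KLProgramme` — crux K3, the nested two-volume pass: TERMWISE VOLUME LIMITS OF THE DEFECT PROFILE THROUGH THE STEP'S INPUT NORM
# (Tannery for `normV`; cell gate-hubbard-kl, seat hubbard-kl-k3c4-p1 g9; memo VL-ROUTE-A-RADIUS-g9.md §3; `--supports` stmt-…-20440)

The two-volume STEP (`…TwoVolumeInductiveStep.sum_norm_kernel_twoVolume_step_le`) reads the incoming deep-pin defect profile `E : ℕ → ℝ` only through the
input norm `normV Γ′ κ′ ρ′ E = Σ_{m ≤ |Γ′|/2} (e²(κ′+ρ′))^{2m} E(m)` of `GrassmannEffectiveActionBound`.  Along the volume `L → ∞` the label types `Γ′_L` grow,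
the defect profile `E_L(m) → 0` for EVERY FIXED degree (induction hypothesis of the rate-free VL stub), and `E_L(m)` is dominated by the one-volume profiles of
the two volumes, whose weighted sum over all degrees is finite uniformly in `L` (the STEP's own smallness).  Tannery's theorem then gives `normV Γ′_L κ′ ρ′ E_L → 0`
— with a FIXED radius `ρ′` per scale and no rate (memo §3: the tree's determinant-bounded steps lose the radius factor `e²·a` per scale, so no L-uniform linear
recursion exists; termwise limits do not care).

* `normV_le_tsum` — `normV Γ κ ρ E ≤ Σ'_m (e²(κ+ρ))^{2m} E(m)` for EVERY finite label type `Γ` (nonnegative summable majorant series);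
* `normV_le_tsum_of_le` — the same against a dominating profile `E ≤ D`;
* **`tendsto_tsum_normVWeight_of_dominated`** — Tannery: `E_i(m) → 0` termwise along a filter, `0 ≤ E_i ≤ D` with `Σ'_m (e²(κ+ρ))^{2m} D(m) < ∞` ⇒
  `Σ'_m (e²(κ+ρ))^{2m} E_i(m) → 0`;
* **`eventually_normV_le_of_dominated`** — hence for every `δ > 0`, eventually along the filter, `normV Γ κ ρ E_i ≤ δ` for EVERY finite `Γ` (the label types of the
  consumer depend on `(L, b, M)`, the envelope `E_i` on `L` only);
* `tendsto_normV_of_dominated` — the `Tendsto` form for a family of label types `Γ_i`;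
* `min_envelope_*` — the envelope `min (f_i m) (D m)` (termwise-vanishing bound ∧ domination) used by the induction.

Pure real analysis; no definition.  References: Tannery's theorem (Mathlib `tendsto_tsum_of_dominated_convergence`); BGM 2006 §3 (role: the per-degree
organisation of the multiscale bounds).
-/

noncomputable section

namespace Summit.HubbardSuperconductivity.HubbardSuperconductivity.Theorems.TwoVolumeDefect

set_option linter.dupNamespace false -- summit = problem name (single-conjunct summit), D-0017

open Finset Filter Topology Literature.MathematicalPhysics.QuantumLattice

/-! ## §1 `normV` under a summable series -/

/-- The `normV` weight is nonnegative. [folklore] -/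
theorem normVWeight_nonneg (κ ρ : ℝ) (hκ : 0 ≤ κ) (hρ : 0 ≤ ρ) (m : ℕ) : 0 ≤ (Real.exp 2 * (κ + ρ)) ^ (2 * m) := by positivity

/-- **`normV` is below the full series**: `normV Γ κ ρ E ≤ Σ'_m (e²(κ+ρ))^{2m} E(m)` for every finite label type `Γ`, whenever `0 ≤ E` and the series is
summable. [folklore] -/
theorem normV_le_tsum {Γ : Type*} [Fintype Γ] {κ ρ : ℝ} (hκ : 0 ≤ κ) (hρ : 0 ≤ ρ) {E : ℕ → ℝ} (hE0 : ∀ m, 0 ≤ E m)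
    (hsum : Summable fun m => (Real.exp 2 * (κ + ρ)) ^ (2 * m) * E m) :
    normV Γ κ ρ E ≤ ∑' m, (Real.exp 2 * (κ + ρ)) ^ (2 * m) * E m := by
  unfold normV
  exact hsum.sum_le_tsum _ fun m _ => mul_nonneg (normVWeight_nonneg κ ρ hκ hρ m) (hE0 m)

/-- **`normV` against a dominating profile**: `0 ≤ E ≤ D`, `Σ'_m (e²(κ+ρ))^{2m} D(m)` summable ⇒ `normV Γ κ ρ E ≤ Σ'_m (e²(κ+ρ))^{2m} D(m)`. [folklore] -/
theorem normV_le_tsum_of_le {Γ : Type*} [Fintype Γ] {κ ρ : ℝ} (hκ : 0 ≤ κ) (hρ : 0 ≤ ρ) {E D : ℕ → ℝ} (hE0 : ∀ m, 0 ≤ E m)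
    (hED : ∀ m, E m ≤ D m) (hsum : Summable fun m => (Real.exp 2 * (κ + ρ)) ^ (2 * m) * D m) :
    normV Γ κ ρ E ≤ ∑' m, (Real.exp 2 * (κ + ρ)) ^ (2 * m) * D m := by
  have hw := normVWeight_nonneg κ ρ hκ hρ
  have hsumE : Summable fun m => (Real.exp 2 * (κ + ρ)) ^ (2 * m) * E m :=
    Summable.of_nonneg_of_le (fun m => mul_nonneg (hw m) (hE0 m)) (fun m => mul_le_mul_of_nonneg_left (hED m) (hw m)) hsum
  exact (normV_le_tsum hκ hρ hE0 hsumE).trans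
    (Summable.tsum_le_tsum (fun m => mul_le_mul_of_nonneg_left (hED m) (hw m)) hsumE hsum)

/-- The dominated series of a nonnegative profile is summable. [folklore] -/
theorem summable_normVWeight_mul_of_le {κ ρ : ℝ} (hκ : 0 ≤ κ) (hρ : 0 ≤ ρ) {E D : ℕ → ℝ} (hE0 : ∀ m, 0 ≤ E m)
    (hED : ∀ m, E m ≤ D m) (hsum : Summable fun m => (Real.exp 2 * (κ + ρ)) ^ (2 * m) * D m) :
    Summable fun m => (Real.exp 2 * (κ + ρ)) ^ (2 * m) * E m :=
  Summable.of_nonneg_of_le (fun m => mul_nonneg (normVWeight_nonneg κ ρ hκ hρ m) (hE0 m))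
    (fun m => mul_le_mul_of_nonneg_left (hED m) (normVWeight_nonneg κ ρ hκ hρ m)) hsum

/-! ## §2 Tannery: termwise limits of a dominated profile -/

/-- **TANNERY FOR THE STEP'S INPUT NORM.**  Along a filter `l`, profiles `E_i : ℕ → ℝ` with `0 ≤ E_i(m) ≤ D(m)` (eventually), `Σ'_m (e²(κ+ρ))^{2m} D(m)`
summable and `E_i(m) → 0` for every fixed degree `m` have `Σ'_m (e²(κ+ρ))^{2m} E_i(m) → 0`.
[folklore: Tannery's theorem, Mathlib `tendsto_tsum_of_dominated_convergence`] -/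
theorem tendsto_tsum_normVWeight_of_dominated {ι : Type*} {l : Filter ι} {κ ρ : ℝ} (hκ : 0 ≤ κ) (hρ : 0 ≤ ρ) (E : ι → ℕ → ℝ) (D : ℕ → ℝ)
    (hE : ∀ᶠ i in l, ∀ m, 0 ≤ E i m ∧ E i m ≤ D m) (hsum : Summable fun m => (Real.exp 2 * (κ + ρ)) ^ (2 * m) * D m)
    (hlim : ∀ m, Tendsto (fun i => E i m) l (𝓝 0)) :
    Tendsto (fun i => ∑' m, (Real.exp 2 * (κ + ρ)) ^ (2 * m) * E i m) l (𝓝 0) := by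
  have hw := normVWeight_nonneg κ ρ hκ hρ
  have h := tendsto_tsum_of_dominated_convergence (𝓕 := l) (f := fun i m => (Real.exp 2 * (κ + ρ)) ^ (2 * m) * E i m)
    (g := fun _ => (0 : ℝ)) (bound := fun m => (Real.exp 2 * (κ + ρ)) ^ (2 * m) * D m) hsum
    (fun m => by simpa using (hlim m).const_mul ((Real.exp 2 * (κ + ρ)) ^ (2 * m)))
    (hE.mono fun i hi m => by
      rw [Real.norm_eq_abs, abs_of_nonneg (mul_nonneg (hw m) (hi m).1)]
      exact mul_le_mul_of_nonneg_left (hi m).2 (hw m))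
  simpa using h

/-- **Eventually `normV ≤ δ`, uniformly in the label type.**  Under the hypotheses of `tendsto_tsum_normVWeight_of_dominated`, for every `δ > 0`, eventually
along `l`: `normV Γ κ ρ E_i ≤ δ` for EVERY finite label type `Γ` (the consumer's `Γ` depends on more parameters than the envelope does). [folklore] -/
theorem eventually_normV_le_of_dominated {ι : Type*} {l : Filter ι} {κ ρ : ℝ} (hκ : 0 ≤ κ) (hρ : 0 ≤ ρ) (E : ι → ℕ → ℝ) (D : ℕ → ℝ)
    (hE : ∀ᶠ i in l, ∀ m, 0 ≤ E i m ∧ E i m ≤ D m) (hsum : Summable fun m => (Real.exp 2 * (κ + ρ)) ^ (2 * m) * D m)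
    (hlim : ∀ m, Tendsto (fun i => E i m) l (𝓝 0)) {δ : ℝ} (hδ : 0 < δ) :
    ∀ᶠ i in l, ∀ (Γ : Type*) [Fintype Γ], normV Γ κ ρ (E i) ≤ δ := by
  have ht := tendsto_tsum_normVWeight_of_dominated hκ hρ E D hE hsum hlim
  have hlt : ∀ᶠ i in l, ∑' m, (Real.exp 2 * (κ + ρ)) ^ (2 * m) * E i m < δ := ht (Iio_mem_nhds hδ)
  filter_upwards [hlt, hE] with i hi hEi Γ _
  have hsumE := summable_normVWeight_mul_of_le hκ hρ (fun m => (hEi m).1) (fun m => (hEi m).2) hsum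
  exact (normV_le_tsum hκ hρ (fun m => (hEi m).1) hsumE).trans hi.le

/-- **`normV Γ_i κ ρ E_i → 0`** for a family of finite label types `Γ_i` along the filter, under termwise vanishing and domination. [folklore] -/
theorem tendsto_normV_of_dominated {ι : Type*} {l : Filter ι} (Γ : ι → Type*) [∀ i, Fintype (Γ i)] {κ ρ : ℝ} (hκ : 0 ≤ κ) (hρ : 0 ≤ ρ)
    (E : ι → ℕ → ℝ) (D : ℕ → ℝ) (hE : ∀ᶠ i in l, ∀ m, 0 ≤ E i m ∧ E i m ≤ D m)
    (hsum : Summable fun m => (Real.exp 2 * (κ + ρ)) ^ (2 * m) * D m) (hlim : ∀ m, Tendsto (fun i => E i m) l (𝓝 0)) :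
    Tendsto (fun i => normV (Γ i) κ ρ (E i)) l (𝓝 0) := by
  have ht := tendsto_tsum_normVWeight_of_dominated hκ hρ E D hE hsum hlim
  refine squeeze_zero' (hE.mono fun i hi => normV_nonneg hκ hρ fun m => (hi m).1) (hE.mono fun i hi => ?_) ht
  exact normV_le_tsum hκ hρ (fun m => (hi m).1) (summable_normVWeight_mul_of_le hκ hρ (fun m => (hi m).1) (fun m => (hi m).2) hsum)

/-! ## §3 The envelope `min (f_i m) (D m)` -/

/-- The envelope is a bound whenever both arguments are. [folklore] -/
theorem le_min_envelope {x f D : ℝ} (hf : x ≤ f) (hD : x ≤ D) : x ≤ min f D := le_min hf hD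

/-- The envelope is nonnegative and dominated. [folklore] -/
theorem min_envelope_nonneg_le {f D : ℝ} (hf : 0 ≤ f) (hD : 0 ≤ D) : 0 ≤ min f D ∧ min f D ≤ D := ⟨le_min hf hD, min_le_right _ _⟩

/-- **The envelope vanishes termwise**: `f_i(m) → 0` and `0 ≤ D(m)` ⇒ `min (f_i m) (D m) → 0`. [folklore] -/
theorem tendsto_min_envelope {ι : Type*} {l : Filter ι} {f : ι → ℝ} (hf : Tendsto f l (𝓝 0)) {D : ℝ} (hD : 0 ≤ D) :
    Tendsto (fun i => min (f i) D) l (𝓝 0) := by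
  simpa [min_eq_left hD] using hf.min (tendsto_const_nhds (x := D))

/-- **The induction's use of Tannery, packaged**: termwise-vanishing nonnegative bounds `f_i(m) → 0` and a nonnegative dominating profile `D` with
`Σ'_m (e²(κ+ρ))^{2m} D(m)` summable give, for every `δ > 0`, eventually along `l`, `normV Γ κ ρ (m ↦ min (f_i m) (D m)) ≤ δ` for every finite `Γ`. [folklore] -/
theorem eventually_normV_min_envelope_le {ι : Type*} {l : Filter ι} {κ ρ : ℝ} (hκ : 0 ≤ κ) (hρ : 0 ≤ ρ) (f : ι → ℕ → ℝ) (D : ℕ → ℝ)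
    (hf0 : ∀ i m, 0 ≤ f i m) (hD0 : ∀ m, 0 ≤ D m) (hsum : Summable fun m => (Real.exp 2 * (κ + ρ)) ^ (2 * m) * D m)
    (hlim : ∀ m, Tendsto (fun i => f i m) l (𝓝 0)) {δ : ℝ} (hδ : 0 < δ) :
    ∀ᶠ i in l, ∀ (Γ : Type*) [Fintype Γ], normV Γ κ ρ (fun m => min (f i m) (D m)) ≤ δ :=
  eventually_normV_le_of_dominated hκ hρ (fun i m => min (f i m) (D m)) D
    (Eventually.of_forall fun i m => min_envelope_nonneg_le (hf0 i m) (hD0 m)) hsum (fun m => tendsto_min_envelope (hlim m) (hD0 m)) hδ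

end Summit.HubbardSuperconductivity.HubbardSuperconductivity.Theorems.TwoVolumeDefect

end
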